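/-
Copyright (c) 2026. All rights reserved.
Released under Apache 2.0 license as described in the file LICENSE.
Authors: abc-iut cell, seat abc-iut-w6-d025 (gen 2; block C / W6, row «Cor36-LOGOBS-TELE»).
-/
import Literature.AnabelianGeometry.AbsoluteAnabelian.AbsTopIII.FrobeniusPictureMLFLogTeleFamily

/-!
# [AbsTopIII] Cor. 3.6 (iii), second clause, telecore half: the two tail identities at `𝒩`

S. Mochizuki, *Topics in Absolute Anabelian Geometry III*, Cor. 3.6 (iii) p. 80 of the kurims
manuscript (`paper:url-5493eb38cbb7`; bib key `MochizukiAbsTopIII2015`).  Continuation of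
`FrobeniusPictureMLFLogTeleFamily.lean`, which assembled the glued family `logTeleFamily` on `𝒟_An`
and `LogObsCompatTelecoreStmt τ` modulo the two axioms of Def. 3.5 (ii) for glued pairs whose target
is `𝒩` (the one vertex whose structure functor over `ℰ` is not faithful).  Here those two identities
are PROVED — in fact for every target vertex of `𝒟_{≤4}`, by a direct computation with the split
homotopies:

* the homotopy of a split pair is `ζ = 𝒰 ≫ B` — the universal homotopy `𝒰` through `Anab` of the
  pair with EQUAL tails (a homotopy of the universal family `anUnivE`, whose family axioms are known)
  followed by the tail homotopy `B = 𝒟_{[γ₂]·φ_⋏} ◁ θ` (`TDec.η_tele_eq`);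
* `B` composes (`teleTail_trans`), satisfies the exchange law with `𝒰`
  (`teleTail_comp_anUnivE`: `(𝒟_{[γ₂]} ◁ β) ≫ (λ ▷ 𝒟_{[τ']}) = (λ ▷ 𝒟_{[τ]}) ≫ (𝒟_{[γ₂']} ◁ β)`), and
  whiskers (`teleTail_whisker_heq`, from the whiskering axiom of `G₁`);
* hence transitivity (`teleGlueη_trans_base`) and whiskering (`teleGlueη_whisker_base`) of the
  glued homotopies at every target of `𝒟_{≤4}`, and **Cor. 3.6 (iii), second clause, telecore
  half** from a family `G₁` on the telecore-free graph lying over `ℰ` and containing the `𝔖_log`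
  family, with no further hypothesis (`logObsCompatTelecoreStmt_of_family'`).

Pure category theory over the abstract data `LogFrobeniusData`; nothing here takes a side on
inter-universal Teichmüller theory or bears on [IUTchIII] Cor. 3.12.
-/

namespace Literature.AnabelianGeometry.AbsoluteAnabelian

open _root_.CategoryTheory _root_.Quiver

universe u

/-! ### Heterogeneous bookkeeping for whiskered natural transformations -/

section HEqToolkit

variable {A B C : Type*} [Category A] [Category B] [Category C]

/-- Whiskering on the left respects heterogeneous equality. [cite: MochizukiAbsTopIII2015, Definition 3.5 (i) p.75] -/
theorem Functor.whiskerLeft_heq {F F' : A ⥤ B} (hF : F = F') {G H G' H' : B ⥤ C} (hG : G = G')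
    (hH : H = H') {α : G ⟶ H} {α' : G' ⟶ H'} (h : α ≍ α') :
    Functor.whiskerLeft F α ≍ Functor.whiskerLeft F' α' := by
  subst hF hG hH
  cases h
  rfl

/-- Whiskering on the right respects heterogeneous equality. [cite: MochizukiAbsTopIII2015, Definition 3.5 (i) p.75] -/
theorem Functor.whiskerRight_heq {F G F' G' : A ⥤ B} (hF : F = F') (hG : G = G') {α : F ⟶ G}
    {α' : F' ⟶ G'} (h : α ≍ α') {T T' : B ⥤ C} (hT : T = T') :
    Functor.whiskerRight α T ≍ Functor.whiskerRight α' T' := by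
  subst hF hG hT
  cases h
  rfl

/-- Identities of equal functors are heterogeneously equal. [cite: MochizukiAbsTopIII2015, Definition 3.5 (i) p.75] -/
theorem Functor.id_heq_id {F G : A ⥤ B} (h : F = G) : (𝟙 F : F ⟶ F) ≍ (𝟙 G : G ⟶ G) := by
  subst h
  rfl

end HEqToolkit

namespace LogFrobeniusData

open DiagramOfCategories

variable (Δ : LogFrobeniusData.{u}) (τ : Δ.TelecoreData)
variable (G₁ : ((Δ.teleDiagram anJ (Δ.anTelMap τ)).comapAlong jS.{u}).HomotopyFamily)

/-! ### The tail homotopies compose and whisker -/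

/-- The tail homotopies `θtail` compose. [cite: MochizukiAbsTopIII2015, Definition 3.5 (ii) p.75] -/
theorem θtail_trans {x y : FVtx.{u}} {u v w : Path x y} (huv : u = v ∨ G₁.E u v)
    (hvw : v = w ∨ G₁.E v w) (huw : u = w ∨ G₁.E u w) :
    Δ.θtail τ G₁ u v huv ≫ Δ.θtail τ G₁ v w hvw = Δ.θtail τ G₁ u w huw := by
  classical
  by_cases h₁ : G₁.E u v
  · by_cases h₂ : G₁.E v w
    · rw [Δ.θtail_of_E τ G₁ huv h₁, Δ.θtail_of_E τ G₁ hvw h₂,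
        Δ.θtail_of_E τ G₁ huw (G₁.isSaturated.trans h₁ h₂), ← Δ.tailη_trans τ G₁ h₁ h₂]
    · obtain rfl := hvw.resolve_right h₂
      rw [θtail_self, Category.comp_id]
  · obtain rfl := huv.resolve_right h₁
    rw [θtail_self, Category.id_comp]

/-- **The tail homotopy of a whiskered pair** `(w₁·u·w, w₁·v·w)` is the tail homotopy of `(u, v)`
whiskered (heterogeneously; the whiskering axiom of `G₁`). [cite: MochizukiAbsTopIII2015, Definition 3.5 (ii) p.75] -/
theorem tailη_whisker_heq {z x y y' : FVtx.{u}} {u v : Path x y} (h : G₁.E u v) (w₁ : Path z x)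
    (w : Path y y') :
    Δ.tailη τ G₁ (G₁.isSaturated.precomp (G₁.isSaturated.postcomp h w) w₁) ≍
      Functor.whiskerLeft ((Δ.teleDiagram anJ (Δ.anTelMap τ)).pathFunctor (jS.mapPath w₁))
        (Functor.whiskerRight (Δ.tailη τ G₁ h)
          ((Δ.teleDiagram anJ (Δ.anTelMap τ)).pathFunctor (jS.mapPath w))) := by
  refine (Δ.tailη_heq τ G₁ _).trans ?_
  rw [G₁.η_whisker h w₁ w]
  refine (HomotopyFamily.heq_eqToHom_comp_comp_eqToHom _ _ _).trans ?_
  exact Functor.whiskerLeft_heq (pathFunctor_comapAlong _ jS w₁)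
    (by rw [pathFunctor_comapAlong, pathFunctor_comapAlong])
    (by rw [pathFunctor_comapAlong, pathFunctor_comapAlong])
    (Functor.whiskerRight_heq (pathFunctor_comapAlong _ jS u) (pathFunctor_comapAlong _ jS v)
      (Δ.tailη_heq τ G₁ h).symm (pathFunctor_comapAlong _ jS w))

/-- The path functor of a doubly composed telecore-free path. [cite: MochizukiAbsTopIII2015, Definition 3.5 (i) p.75] -/
theorem pathFunctor_jS_comp₃ {z x y y' : FVtx.{u}} (w₁ : Path z x) (u : Path x y) (w : Path y y') :
    (Δ.teleDiagram anJ (Δ.anTelMap τ)).pathFunctor (jS.mapPath (w₁.comp (u.comp w))) =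
      (Δ.teleDiagram anJ (Δ.anTelMap τ)).pathFunctor (jS.mapPath w₁) ⋙
        ((Δ.teleDiagram anJ (Δ.anTelMap τ)).pathFunctor (jS.mapPath u) ⋙
          (Δ.teleDiagram anJ (Δ.anTelMap τ)).pathFunctor (jS.mapPath w)) := by
  rw [Prefunctor.mapPath_comp, Prefunctor.mapPath_comp, pathFunctor_comp, pathFunctor_comp]

/-- The path functor of a doubly composed path. [cite: MochizukiAbsTopIII2015, Definition 3.5 (i) p.75] -/
theorem pathFunctor_comp₃ {c a b d : (teleShape anJ.{u}).Vertex} (r₁ : Path c a) (P : Path a b)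
    (r₂ : Path b d) :
    (Δ.teleDiagram anJ (Δ.anTelMap τ)).pathFunctor (r₁.comp (P.comp r₂)) =
      (Δ.teleDiagram anJ (Δ.anTelMap τ)).pathFunctor r₁ ⋙
        ((Δ.teleDiagram anJ (Δ.anTelMap τ)).pathFunctor P ⋙
          (Δ.teleDiagram anJ (Δ.anTelMap τ)).pathFunctor r₂) := by
  rw [pathFunctor_comp, pathFunctor_comp]

/-- `θtail` of a whiskered pair is `θtail` whiskered (heterogeneously).
[cite: MochizukiAbsTopIII2015, Definition 3.5 (ii) p.75] -/
theorem θtail_whisker_heq {z x y y' : FVtx.{u}} {u v : Path x y} (huv : u = v ∨ G₁.E u v)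
    (w₁ : Path z x) (w : Path y y')
    (h' : w₁.comp (u.comp w) = w₁.comp (v.comp w) ∨ G₁.E (w₁.comp (u.comp w)) (w₁.comp (v.comp w))) :
    Δ.θtail τ G₁ _ _ h' ≍
      Functor.whiskerLeft ((Δ.teleDiagram anJ (Δ.anTelMap τ)).pathFunctor (jS.mapPath w₁))
        (Functor.whiskerRight (Δ.θtail τ G₁ u v huv)
          ((Δ.teleDiagram anJ (Δ.anTelMap τ)).pathFunctor (jS.mapPath w))) := by
  classical
  by_cases h : G₁.E u v
  · rw [Δ.θtail_of_E τ G₁ h' (G₁.isSaturated.precomp (G₁.isSaturated.postcomp h w) w₁),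
      Δ.θtail_of_E τ G₁ huv h]
    exact Δ.tailη_whisker_heq τ G₁ h w₁ w
  · obtain rfl := huv.resolve_right h
    rw [θtail_self, θtail_self, Functor.whiskerRight_id', Functor.whiskerLeft_id']
    exact Functor.id_heq_id (Δ.pathFunctor_jS_comp₃ τ w₁ u w)

/-- `θtail` of a post-composed pair is `θtail` whiskered on the right (heterogeneously).
[cite: MochizukiAbsTopIII2015, Definition 3.5 (ii) p.75] -/
theorem θtail_postcomp_heq {x y y' : FVtx.{u}} {u v : Path x y} (huv : u = v ∨ G₁.E u v)
    (w : Path y y') (h' : u.comp w = v.comp w ∨ G₁.E (u.comp w) (v.comp w)) :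
    Δ.θtail τ G₁ _ _ h' ≍
      Functor.whiskerRight (Δ.θtail τ G₁ u v huv)
        ((Δ.teleDiagram anJ (Δ.anTelMap τ)).pathFunctor (jS.mapPath w)) := by
  -- whisker on the left along the EMPTY path, then drop the identity functor
  have h'' : Path.nil.comp (u.comp w) = Path.nil.comp (v.comp w) ∨
      G₁.E (Path.nil.comp (u.comp w)) (Path.nil.comp (v.comp w)) := by
    rw [Path.nil_comp, Path.nil_comp]; exact h'
  have e₁ : ∀ {P Q P' Q' : Path x y'} (hP : P = P') (hQ : Q = Q') (h₁ : P = Q ∨ G₁.E P Q)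
      (h₂ : P' = Q' ∨ G₁.E P' Q'), Δ.θtail τ G₁ P Q h₁ ≍ Δ.θtail τ G₁ P' Q' h₂ := by
    intro P Q P' Q' hP hQ h₁ h₂; subst hP hQ; rfl
  refine (e₁ (Path.nil_comp _).symm (Path.nil_comp _).symm h' h'').trans ?_
  refine (Δ.θtail_whisker_heq τ G₁ huv Path.nil w h'').trans ?_
  -- `𝒟_{jS nil} = 𝟭`, and `𝟭 ◁ β = β` definitionally
  rw [Prefunctor.mapPath_nil, pathFunctor_nil]
  exact HEq.rfl

/-! ### The homotopy of a split pair: universal part and tail part -/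

/-- **The tail part** of the homotopy of a split pair: the tail homotopy `θ(u, v)` whiskered along
the prefix `[γ₂]·φ_⋏`. [cite: MochizukiAbsTopIII2015, Corollary 3.6 (iii) p.80] -/
noncomputable def teleTail {a : (teleShape anJ.{u}).Vertex} {γ β : SubVertex {a : LFVertex | a.row ≤ 4}}
    (q : Path a (teleShape anJ.{u}).obs) (j : anJ.{u} γ)
    (u v : Path (⟨(teleShape anJ.{u}).base γ⟩ : FVtx.{u}) ⟨(teleShape anJ.{u}).base β⟩)
    (huv : u = v ∨ G₁.E u v) :
    (Δ.teleDiagram anJ (Δ.anTelMap τ)).pathFunctor ((q.cons (phiEdge j)).comp (jS.mapPath u)) ⟶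
      (Δ.teleDiagram anJ (Δ.anTelMap τ)).pathFunctor ((q.cons (phiEdge j)).comp (jS.mapPath v)) :=
  Δ.preWhisker τ (q.cons (phiEdge j)) (Δ.θtail τ G₁ u v huv)

/-- The split pair with EQUAL tails lies in the universal boundary set through `Anab`.
[cite: MochizukiAbsTopIII2015, Definition 3.5 (iv) p.76] -/
theorem anUnivE_E_tele {a : (teleShape anJ.{u}).Vertex} {γ β : SubVertex {a : LFVertex | a.row ≤ 4}}
    (p q : Path a (teleShape anJ.{u}).obs) (j : anJ.{u} γ)
    (u : Path (⟨(teleShape anJ.{u}).base γ⟩ : FVtx.{u}) ⟨(teleShape anJ.{u}).base β⟩) :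
    (Δ.anUnivE τ).E ((p.cons (phiEdge j)).comp (jS.mapPath u)) ((q.cons (phiEdge j)).comp (jS.mapPath u)) :=
  (Δ.anUnivE_E_iff τ _ _).mpr
    ⟨⟨_, rfl, p, q, tailPath j u, split_eq_comp_tailPath p j u, split_eq_comp_tailPath q j u⟩⟩

/-- The universal homotopy of the split pair with equal tails is the whiskered lift of the prefixes
(heterogeneously). [cite: MochizukiAbsTopIII2015, Definition 3.5 (iv) p.76] -/
theorem anUnivE_η_tele_heq {a : (teleShape anJ.{u}).Vertex} {γ β : SubVertex {a : LFVertex | a.row ≤ 4}}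
    (p q : Path a (teleShape anJ.{u}).obs) (j : anJ.{u} γ)
    (u : Path (⟨(teleShape anJ.{u}).base γ⟩ : FVtx.{u}) ⟨(teleShape anJ.{u}).base β⟩)
    (h : (Δ.anUnivE τ).E ((p.cons (phiEdge j)).comp (jS.mapPath u))
      ((q.cons (phiEdge j)).comp (jS.mapPath u))) :
    (Δ.anUnivE τ).η h ≍
      Functor.whiskerRight ((Δ.teleOverE τ).lift (Δ.anFFE τ _ rfl) p q)
        ((Δ.teleDiagram anJ (Δ.anTelMap τ)).pathFunctor (tailPath j u)) := by
  rw [Δ.anUnivE_η_eq_decomp τ h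
    ⟨_, rfl, p, q, tailPath j u, split_eq_comp_tailPath p j u, split_eq_comp_tailPath q j u⟩]
  exact HomotopyFamily.heq_eqToHom_comp_comp_eqToHom _ _ _

/-- **The homotopy of a split pair is the universal homotopy of the equal-tailed pair followed by the
tail part**: `ζ = 𝒰 ≫ B`. [cite: MochizukiAbsTopIII2015, Corollary 3.6 (iii) p.80] -/
theorem TDec.η_tele_eq {a : (teleShape anJ.{u}).Vertex} {γ β : SubVertex {a : LFVertex | a.row ≤ 4}}
    (p q : Path a (teleShape anJ.{u}).obs) (j : anJ.{u} γ)
    (u v : Path (⟨(teleShape anJ.{u}).base γ⟩ : FVtx.{u}) ⟨(teleShape anJ.{u}).base β⟩)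
    (huv : u = v ∨ G₁.E u v) :
    (TDec.tele p q j u v huv : Δ.TDec τ G₁ _ _).η =
      (Δ.anUnivE τ).η (Δ.anUnivE_E_tele τ p q j u) ≫ Δ.teleTail τ G₁ q j u v huv := by
  have hA : eqToHom (congrArg (Δ.teleDiagram anJ (Δ.anTelMap τ)).pathFunctor
        (split_eq_comp_tailPath p j u)) ≫ Δ.liftTail τ p q (tailPath j u) ≫
        eqToHom (congrArg (Δ.teleDiagram anJ (Δ.anTelMap τ)).pathFunctor
          (split_eq_comp_tailPath q j u)).symm =
      (Δ.anUnivE τ).η (Δ.anUnivE_E_tele τ p q j u) :=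
    eq_of_heq <| (HomotopyFamily.heq_eqToHom_comp_comp_eqToHom _ _ _).trans
      ((Δ.liftTail_heq τ p q _).trans (Δ.anUnivE_η_tele_heq τ p q j u _).symm)
  calc (TDec.tele p q j u v huv : Δ.TDec τ G₁ _ _).η
      = eqToHom (congrArg (Δ.teleDiagram anJ (Δ.anTelMap τ)).pathFunctor
            (split_eq_comp_tailPath p j u)) ≫ Δ.liftTail τ p q (tailPath j u) ≫
          eqToHom (congrArg (Δ.teleDiagram anJ (Δ.anTelMap τ)).pathFunctor
            (split_eq_comp_tailPath q j u)).symm ≫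
          Δ.preWhisker τ (q.cons (phiEdge j)) (Δ.θtail τ G₁ u v huv) := rfl
    _ = (eqToHom (congrArg (Δ.teleDiagram anJ (Δ.anTelMap τ)).pathFunctor
            (split_eq_comp_tailPath p j u)) ≫ Δ.liftTail τ p q (tailPath j u) ≫
          eqToHom (congrArg (Δ.teleDiagram anJ (Δ.anTelMap τ)).pathFunctor
            (split_eq_comp_tailPath q j u)).symm) ≫
          Δ.preWhisker τ (q.cons (phiEdge j)) (Δ.θtail τ G₁ u v huv) := by
        simp only [Category.assoc]
    _ = _ := by rw [hA]; rfl

/-- `preWhisker` is compatible with composition. [cite: MochizukiAbsTopIII2015, Definition 3.5 (ii) p.75] -/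
theorem preWhisker_comp {c a b : (teleShape anJ.{u}).Vertex} (r : Path c a) {P Q R : Path a b}
    (θ : (Δ.teleDiagram anJ (Δ.anTelMap τ)).pathFunctor P ⟶ (Δ.teleDiagram anJ (Δ.anTelMap τ)).pathFunctor Q)
    (θ' : (Δ.teleDiagram anJ (Δ.anTelMap τ)).pathFunctor Q ⟶ (Δ.teleDiagram anJ (Δ.anTelMap τ)).pathFunctor R) :
    Δ.preWhisker τ r θ ≫ Δ.preWhisker τ r θ' = Δ.preWhisker τ r (θ ≫ θ') := by
  simp only [preWhisker, Category.assoc, eqToHom_trans_assoc, eqToHom_refl, Category.id_comp,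
    Functor.whiskerLeft_comp]

/-- The tail parts compose. [cite: MochizukiAbsTopIII2015, Definition 3.5 (ii) p.75] -/
theorem teleTail_trans {a : (teleShape anJ.{u}).Vertex} {γ β : SubVertex {a : LFVertex | a.row ≤ 4}}
    (q : Path a (teleShape anJ.{u}).obs) (j : anJ.{u} γ)
    {u v w : Path (⟨(teleShape anJ.{u}).base γ⟩ : FVtx.{u}) ⟨(teleShape anJ.{u}).base β⟩}
    (huv : u = v ∨ G₁.E u v) (hvw : v = w ∨ G₁.E v w) (huw : u = w ∨ G₁.E u w) :
    Δ.teleTail τ G₁ q j u v huv ≫ Δ.teleTail τ G₁ q j v w hvw = Δ.teleTail τ G₁ q j u w huw :=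
  (Δ.preWhisker_comp τ _ _ _).trans
    (congrArg (Δ.preWhisker τ (q.cons (phiEdge j))) (Δ.θtail_trans τ G₁ huv hvw huw))

/-- The tail part is the tail homotopy whiskered along `𝒟_{[γ₂]}` and `𝒟_{φ_⋏}` (heterogeneously).
[cite: MochizukiAbsTopIII2015, Definition 3.5 (ii) p.75] -/
theorem teleTail_heq {a : (teleShape anJ.{u}).Vertex} {γ β : SubVertex {a : LFVertex | a.row ≤ 4}}
    (q : Path a (teleShape anJ.{u}).obs) (j : anJ.{u} γ)
    {u v : Path (⟨(teleShape anJ.{u}).base γ⟩ : FVtx.{u}) ⟨(teleShape anJ.{u}).base β⟩}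
    (huv : u = v ∨ G₁.E u v) :
    Δ.teleTail τ G₁ q j u v huv ≍
      Functor.whiskerLeft ((Δ.teleDiagram anJ (Δ.anTelMap τ)).pathFunctor q)
        (Functor.whiskerLeft ((Δ.teleDiagram anJ (Δ.anTelMap τ)).map (phiEdge j))
          (Δ.θtail τ G₁ u v huv)) := by
  refine (HomotopyFamily.heq_eqToHom_comp_comp_eqToHom _ _ _).trans ?_
  rw [pathFunctor_cons]
  exact HEq.rfl

/-- The path functor of a tail `φ_⋏ · jS u` is `𝒟_{φ_⋏}` followed by `𝒟_{jS u}`.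
[cite: MochizukiAbsTopIII2015, Definition 3.5 (i) p.75] -/
theorem pathFunctor_tailPath {γ β : SubVertex {a : LFVertex | a.row ≤ 4}} (j : anJ.{u} γ)
    (u : Path (⟨(teleShape anJ.{u}).base γ⟩ : FVtx.{u}) ⟨(teleShape anJ.{u}).base β⟩) :
    (Δ.teleDiagram anJ (Δ.anTelMap τ)).pathFunctor (tailPath j u) =
      (Δ.teleDiagram anJ (Δ.anTelMap τ)).map (phiEdge j) ⋙
        (Δ.teleDiagram anJ (Δ.anTelMap τ)).pathFunctor (jS.mapPath u) := by
  rw [tailPath, pathFunctor_comp, pathFunctor_cons, pathFunctor_nil]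
  rfl

/-- The path functor of a split path. [cite: MochizukiAbsTopIII2015, Definition 3.5 (i) p.75] -/
theorem pathFunctor_split {a : (teleShape anJ.{u}).Vertex} {γ β : SubVertex {a : LFVertex | a.row ≤ 4}}
    (q : Path a (teleShape anJ.{u}).obs) (j : anJ.{u} γ)
    (u : Path (⟨(teleShape anJ.{u}).base γ⟩ : FVtx.{u}) ⟨(teleShape anJ.{u}).base β⟩) :
    (Δ.teleDiagram anJ (Δ.anTelMap τ)).pathFunctor ((q.cons (phiEdge j)).comp (jS.mapPath u)) =
      (Δ.teleDiagram anJ (Δ.anTelMap τ)).pathFunctor q ⋙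
        ((Δ.teleDiagram anJ (Δ.anTelMap τ)).map (phiEdge j) ⋙
          (Δ.teleDiagram anJ (Δ.anTelMap τ)).pathFunctor (jS.mapPath u)) := by
  rw [split_eq_comp_tailPath, pathFunctor_comp, pathFunctor_tailPath]

/-- **Exchange law** between the tail part and the universal part: `B ≫ 𝒰 = 𝒰 ≫ B` (naturality;
the two act on different segments of the path). [cite: MochizukiAbsTopIII2015, Corollary 3.6 (iii) p.81] -/
theorem teleTail_comp_anUnivE {a : (teleShape anJ.{u}).Vertex} {γ β : SubVertex {a : LFVertex | a.row ≤ 4}}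
    (q q' : Path a (teleShape anJ.{u}).obs) (j : anJ.{u} γ)
    {u v : Path (⟨(teleShape anJ.{u}).base γ⟩ : FVtx.{u}) ⟨(teleShape anJ.{u}).base β⟩}
    (huv : u = v ∨ G₁.E u v) :
    Δ.teleTail τ G₁ q j u v huv ≫ (Δ.anUnivE τ).η (Δ.anUnivE_E_tele τ q q' j v) =
      (Δ.anUnivE τ).η (Δ.anUnivE_E_tele τ q q' j u) ≫ Δ.teleTail τ G₁ q' j u v huv := by
  have hA : ∀ (w : Path (⟨(teleShape anJ.{u}).base γ⟩ : FVtx.{u}) ⟨(teleShape anJ.{u}).base β⟩)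
      (h : (Δ.anUnivE τ).E ((q.cons (phiEdge j)).comp (jS.mapPath w))
        ((q'.cons (phiEdge j)).comp (jS.mapPath w))),
      (Δ.anUnivE τ).η h ≍ Functor.whiskerRight ((Δ.teleOverE τ).lift (Δ.anFFE τ _ rfl) q q')
        ((Δ.teleDiagram anJ (Δ.anTelMap τ)).map (phiEdge j) ⋙
          (Δ.teleDiagram anJ (Δ.anTelMap τ)).pathFunctor (jS.mapPath w)) := fun w h =>
    (Δ.anUnivE_η_tele_heq τ q q' j w h).trans
      (Functor.whiskerRight_heq rfl rfl HEq.rfl (Δ.pathFunctor_tailPath τ j w))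
  apply eq_of_heq
  refine (heq_comp (Δ.pathFunctor_split τ q j u) (Δ.pathFunctor_split τ q j v)
    (Δ.pathFunctor_split τ q' j v) (Δ.teleTail_heq τ G₁ q j huv) (hA v _)).trans ?_
  refine (heq_of_eq (Functor.whiskerLeft_comp_whiskerRight
    (F := (Δ.teleDiagram anJ (Δ.anTelMap τ)).pathFunctor q)
    (G := (Δ.teleDiagram anJ (Δ.anTelMap τ)).pathFunctor q')
    ((Δ.teleOverE τ).lift (Δ.anFFE τ _ rfl) q q')
    (Functor.whiskerLeft ((Δ.teleDiagram anJ (Δ.anTelMap τ)).map (phiEdge j))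
      (Δ.θtail τ G₁ u v huv)))).trans ?_
  exact (heq_comp (Δ.pathFunctor_split τ q j u) (Δ.pathFunctor_split τ q' j u)
    (Δ.pathFunctor_split τ q' j v) (hA u _) (Δ.teleTail_heq τ G₁ q' j huv)).symm

/-! ### Transitivity at a target vertex of `𝒟_{≤4}` -/

/-- The relation "equal or `G₁`-related" on tails is transitive. [cite: MochizukiAbsTopIII2015, Section 0 p.26] -/
theorem tailRel_trans' {x y : FVtx.{u}} {u v w : Path x y} (h₁ : u = v ∨ G₁.E u v)
    (h₂ : v = w ∨ G₁.E v w) : u = w ∨ G₁.E u w := by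
  rcases h₁ with rfl | h₁
  · exact h₂
  · rcases h₂ with rfl | h₂
    · exact Or.inr h₁
    · exact Or.inr (G₁.isSaturated.trans h₁ h₂)

/-- **Transitivity of the glued homotopies at a target vertex of `𝒟_{≤4}`** (Def. 3.5 (ii):
`ζ_{ϖ''} = ζ_{ϖ'} ∘ ζ_ϖ`): two composable glued pairs are both `free` (then `tailη_trans`) or both
split through the same `φ_⋏` (then `𝒰 B 𝒰' B' = 𝒰 𝒰' B B'` by the exchange law).
[cite: MochizukiAbsTopIII2015, Definition 3.5 (ii) p.75] -/
theorem teleGlueη_trans_base {a : (teleShape anJ.{u}).Vertex} {β : SubVertex {a : LFVertex | a.row ≤ 4}}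
    {P Q R : Path a ((teleShape anJ.{u}).base β)} (h₁ : TGlueE G₁.E P Q) (h₂ : TGlueE G₁.E Q R)
    (h₃ : TGlueE G₁.E P R) :
    Δ.teleGlueη τ G₁ h₃ = Δ.teleGlueη τ G₁ h₁ ≫ Δ.teleGlueη τ G₁ h₂ := by
  obtain ⟨d₁⟩ := Δ.nonempty_tDec τ G₁ h₁
  obtain ⟨d₂⟩ := Δ.nonempty_tDec τ G₁ h₂
  rw [Δ.teleGlueη_eq_η τ G₁ h₁ d₁, Δ.teleGlueη_eq_η τ G₁ h₂ d₂]
  rcases d₁.inv_base with ⟨α, ha, u, v, h, hP, hQ, hη⟩ | ⟨γ, p, q, j, u, v, huv, hP, hQ, hη⟩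
  · subst ha
    cases hP
    cases hQ
    rcases d₂.inv_base with ⟨α', ha', u', v', h', hP', hQ', hη'⟩ |
      ⟨γ', p', q', j', u', v', huv', hP', hQ', hη'⟩
    · cases ha'
      obtain rfl := jS_mapPath_injective _ _ (eq_of_heq hP')
      cases hQ'
      rw [eq_of_heq hη, eq_of_heq hη', ← tailη_trans,
        Δ.teleGlueη_eq_η τ G₁ h₃ (TDec.free u v' (G₁.isSaturated.trans h h'))]
      rfl
    · exact absurd hP' (jS_mapPath_ne_tele _ _ _ _)
  · subst hP
    subst hQ
    rcases d₂.inv_base with ⟨α', ha', u', v', h', hP', hQ', hη'⟩ |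
      ⟨γ', p', q', j', u', v', huv', hP', hQ', hη'⟩
    · cases ha'
      exact absurd (eq_of_heq hP').symm (jS_mapPath_ne_tele _ _ _ _)
    · obtain ⟨hγ, rfl, hj, hu⟩ := tele_decomp_unique _ _ _ _ _ _ hP'
      cases hγ
      cases hj
      cases hu
      subst hQ'
      simp only [eqToHom_refl, Category.id_comp, Category.comp_id] at hη hη'
      rw [hη, hη', Δ.teleGlueη_eq_η τ G₁ h₃ (TDec.tele p q' j u v' (Δ.tailRel_trans' τ G₁ huv huv')),
        TDec.η_tele_eq, TDec.η_tele_eq, TDec.η_tele_eq, Category.assoc,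
        ← Category.assoc (Δ.teleTail τ G₁ q j u v huv), teleTail_comp_anUnivE, Category.assoc,
        teleTail_trans, ← Category.assoc, ← (Δ.anUnivE τ).η_trans]

/-! ### Whiskering at a target vertex of `𝒟_{≤4}` -/

/-- Two glued homotopies of EQUAL pairs agree (heterogeneously). [cite: MochizukiAbsTopIII2015, Corollary 3.6 (iii) p.80] -/
theorem teleGlueη_heq_teleGlueη {a b : (teleShape anJ.{u}).Vertex} {P Q P' Q' : Path a b} (hP : P = P')
    (hQ : Q = Q') (h : TGlueE G₁.E P Q) (h' : TGlueE G₁.E P' Q') :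
    Δ.teleGlueη τ G₁ h ≍ Δ.teleGlueη τ G₁ h' := by
  subst hP hQ
  rfl

/-- Two homotopies of a family at EQUAL pairs agree (heterogeneously). [cite: MochizukiAbsTopIII2015, Definition 3.5 (ii) p.75] -/
theorem _root_.Literature.AnabelianGeometry.AbsoluteAnabelian.DiagramOfCategories.HomotopyFamily.η_heq_η
    {V : Type*} [Quiver V] {D : DiagramOfCategories V} (K : D.HomotopyFamily) {a b : V}
    {p p' q q' : Path a b} (hp : p = p') (hq : q = q') (h : K.E p q) (h' : K.E p' q') :
    K.η h ≍ K.η h' := by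
  subst hp hq
  rfl

/-- The relation "equal or `G₁`-related" on tails is post-composable. [cite: MochizukiAbsTopIII2015, Section 0 p.26] -/
theorem tailRel_postcomp' {x y z : FVtx.{u}} {u v : Path x y} (h : u = v ∨ G₁.E u v) (w : Path y z) :
    u.comp w = v.comp w ∨ G₁.E (u.comp w) (v.comp w) := by
  rcases h with rfl | h
  · exact Or.inl rfl
  · exact Or.inr (G₁.isSaturated.postcomp h w)

/-- Re-bracketing of a whiskered split pair (path bookkeeping). [cite: MochizukiAbsTopIII2015, Section 0 p.26] -/
theorem comp_split_comp {c a : (teleShape anJ.{u}).Vertex} {γ β δ : SubVertex {a : LFVertex | a.row ≤ 4}}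
    (r₁ : Path c a) (p : Path a (teleShape anJ.{u}).obs) (j : anJ.{u} γ)
    (u : Path (⟨(teleShape anJ.{u}).base γ⟩ : FVtx.{u}) ⟨(teleShape anJ.{u}).base β⟩)
    (w : Path (⟨(teleShape anJ.{u}).base β⟩ : FVtx.{u}) ⟨(teleShape anJ.{u}).base δ⟩) :
    r₁.comp (((p.cons (phiEdge j)).comp (jS.mapPath u)).comp (jS.mapPath w)) =
      ((r₁.comp p).cons (phiEdge j)).comp (jS.mapPath (u.comp w)) := by
  erw [Prefunctor.mapPath_comp, Path.comp_assoc, ← Path.comp_cons, Path.comp_assoc]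
  rfl

/-- Re-bracketing of a doubly whiskered telecore-free path (path bookkeeping). [cite: MochizukiAbsTopIII2015, Section 0 p.26] -/
theorem jS_comp₃ {z x y y' : FVtx.{u}} (w₁ : Path z x) (R : Path x y) (w : Path y y') :
    (jS.mapPath w₁).comp ((jS.mapPath R).comp (jS.mapPath w)) = jS.mapPath (w₁.comp (R.comp w)) := by
  rw [Prefunctor.mapPath_comp, Prefunctor.mapPath_comp]

/-- Re-bracketing of a split path followed by two telecore-free segments (path bookkeeping).
[cite: MochizukiAbsTopIII2015, Section 0 p.26] -/
theorem split_comp_jS_comp {c : (teleShape anJ.{u}).Vertex} {γ α β δ : SubVertex {a : LFVertex | a.row ≤ 4}}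
    (r₁₁ : Path c (teleShape anJ.{u}).obs) (j : anJ.{u} γ)
    (w₁ : Path (⟨(teleShape anJ.{u}).base γ⟩ : FVtx.{u}) ⟨(teleShape anJ.{u}).base α⟩)
    (R : Path (⟨(teleShape anJ.{u}).base α⟩ : FVtx.{u}) ⟨(teleShape anJ.{u}).base β⟩)
    (w : Path (⟨(teleShape anJ.{u}).base β⟩ : FVtx.{u}) ⟨(teleShape anJ.{u}).base δ⟩) :
    ((r₁₁.cons (phiEdge j)).comp (jS.mapPath w₁)).comp ((jS.mapPath R).comp (jS.mapPath w)) =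
      (r₁₁.cons (phiEdge j)).comp (jS.mapPath (w₁.comp (R.comp w))) := by
  erw [Path.comp_assoc, jS_comp₃]
  rfl

section Whisker

variable (hover : ∀ ⦃x y : FVtx.{u}⦄ ⦃u v : Path x y⦄ (h : G₁.E u v),
  (Δ.teleOverE τ).IsOver (jS.mapPath u) (jS.mapPath v) (Δ.tailη τ G₁ h))
include hover

/-- **Whiskering, when the right whisker `[r₂] = [r₂₁]·[s]` visits `Anab`**: the whiskered pair
factors through `Anab`, so its glued homotopy is the universal one — the lift of the prefix pair
`([r₁]·P·[r₂₁], [r₁]·Q·[r₂₁])` (itself the whiskered glued homotopy, by uniqueness at the faithful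
target `Anab`) whiskered along `[s]`. [cite: MochizukiAbsTopIII2015, Corollary 3.6 (iii) p.81] -/
theorem teleGlueη_whisker_through_obs {c a b d : (teleShape anJ.{u}).Vertex} {P Q : Path a b}
    (h : TGlueE G₁.E P Q) (r₁ : Path c a) (r₂₁ : Path b (teleShape anJ.{u}).obs)
    (s : Path (teleShape anJ.{u}).obs d)
    (h' : TGlueE G₁.E (r₁.comp (P.comp (r₂₁.comp s))) (r₁.comp (Q.comp (r₂₁.comp s)))) :
    Δ.teleGlueη τ G₁ h' =
      eqToHom (Δ.pathFunctor_comp₃ τ r₁ P (r₂₁.comp s)) ≫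
        Functor.whiskerLeft ((Δ.teleDiagram anJ (Δ.anTelMap τ)).pathFunctor r₁)
          (Functor.whiskerRight (Δ.teleGlueη τ G₁ h)
            ((Δ.teleDiagram anJ (Δ.anTelMap τ)).pathFunctor (r₂₁.comp s))) ≫
        eqToHom (Δ.pathFunctor_comp₃ τ r₁ Q (r₂₁.comp s)).symm := by
  have e : ∀ R : Path a b, r₁.comp (R.comp (r₂₁.comp s)) = (r₁.comp (R.comp r₂₁)).comp s :=
    fun R => by rw [Path.comp_assoc, Path.comp_assoc]
  -- the prefix pair into `Anab`
  have hobs : TGlueE G₁.E (r₁.comp (P.comp r₂₁)) (r₁.comp (Q.comp r₂₁)) := TGlueE.obs _ _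
  have H1 := Δ.teleGlueη_whisker_of_faithful τ G₁ hover (Δ.teleOverE_faithful_obs τ) h r₁ r₂₁ hobs
  have H2 : Δ.teleGlueη τ G₁ hobs =
      (Δ.teleOverE τ).lift (Δ.anFFE τ _ rfl) (r₁.comp (P.comp r₂₁)) (r₁.comp (Q.comp r₂₁)) :=
    Δ.teleGlueη_eq_η τ G₁ hobs (TDec.obs _ _)
  have h₁ : (Δ.anUnivE τ).E ((r₁.comp (P.comp r₂₁)).comp s) ((r₁.comp (Q.comp r₂₁)).comp s) :=
    (Δ.anUnivE_E_iff τ _ _).mpr ⟨⟨_, rfl, _, _, s, rfl, rfl⟩⟩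
  have hL : (Δ.anUnivE τ).η h₁ ≍
      Functor.whiskerRight (Δ.teleGlueη τ G₁ hobs) ((Δ.teleDiagram anJ (Δ.anTelMap τ)).pathFunctor s) := by
    rw [Δ.anUnivE_η_eq_decomp τ h₁ ⟨_, rfl, _, _, s, rfl, rfl⟩, H2]
    exact HomotopyFamily.heq_eqToHom_comp_comp_eqToHom _ _ _
  refine (conj_eqToHom_iff_heq _ _ (Δ.pathFunctor_comp₃ τ r₁ P (r₂₁.comp s))
    (Δ.pathFunctor_comp₃ τ r₁ Q (r₂₁.comp s))).mpr ?_
  refine (Δ.teleGlueη_heq_teleGlueη τ G₁ (e P) (e Q) h' (tGlueE_postcomp_obs _ _ s)).trans ?_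
  refine (Δ.anUnivE_η_heq_teleGlueη τ G₁ _ _ s h₁ _).symm.trans (hL.trans ?_)
  rw [H1]
  refine (Functor.whiskerRight_heq (Δ.pathFunctor_comp₃ τ r₁ P r₂₁) (Δ.pathFunctor_comp₃ τ r₁ Q r₂₁)
    (HomotopyFamily.heq_eqToHom_comp_comp_eqToHom _ _ _) rfl).trans ?_
  -- re-bracket (definitional) and merge `𝒟_{[r₂₁]} ⋙ 𝒟_{[s]} = 𝒟_{[r₂₁]·[s]}`
  have hT := ((Δ.teleDiagram anJ (Δ.anTelMap τ)).pathFunctor_comp r₂₁ s).symm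
  exact Functor.whiskerLeft_heq (F := (Δ.teleDiagram anJ (Δ.anTelMap τ)).pathFunctor r₁) rfl
    (congrArg ((Δ.teleDiagram anJ (Δ.anTelMap τ)).pathFunctor P ⋙ ·) hT)
    (congrArg ((Δ.teleDiagram anJ (Δ.anTelMap τ)).pathFunctor Q ⋙ ·) hT)
    (Functor.whiskerRight_heq rfl rfl (HEq.refl (Δ.teleGlueη τ G₁ h)) hT)

omit hover in
/-- **Whiskering of a `free` pair along telecore-free whiskers** (the right whisker `jS w`, the left
whisker telecore-free or split): by the whiskering axiom of `G₁` (`θtail_whisker_heq`).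
[cite: MochizukiAbsTopIII2015, Corollary 3.6 (iii) p.81] -/
theorem teleGlueη_whisker_free {c : (teleShape anJ.{u}).Vertex} {α β δ : SubVertex {a : LFVertex | a.row ≤ 4}}
    (u v : Path (⟨(teleShape anJ.{u}).base α⟩ : FVtx.{u}) ⟨(teleShape anJ.{u}).base β⟩) (hE : G₁.E u v)
    (r₁ : Path c ((teleShape anJ.{u}).base α))
    (w : Path (⟨(teleShape anJ.{u}).base β⟩ : FVtx.{u}) ⟨(teleShape anJ.{u}).base δ⟩)
    (h' : TGlueE G₁.E (r₁.comp ((jS.mapPath u).comp (jS.mapPath w)))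
      (r₁.comp ((jS.mapPath v).comp (jS.mapPath w)))) :
    Δ.teleGlueη τ G₁ h' =
      eqToHom (Δ.pathFunctor_comp₃ τ r₁ _ _) ≫
        Functor.whiskerLeft ((Δ.teleDiagram anJ (Δ.anTelMap τ)).pathFunctor r₁)
          (Functor.whiskerRight (TDec.free u v hE : Δ.TDec τ G₁ _ _).η
            ((Δ.teleDiagram anJ (Δ.anTelMap τ)).pathFunctor (jS.mapPath w))) ≫
        eqToHom (Δ.pathFunctor_comp₃ τ r₁ _ _).symm := by
  refine (conj_eqToHom_iff_heq _ _ (Δ.pathFunctor_comp₃ τ r₁ _ _)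
    (Δ.pathFunctor_comp₃ τ r₁ _ _)).mpr ?_
  change _ ≍ Functor.whiskerLeft _ (Functor.whiskerRight (Δ.tailη τ G₁ hE) _)
  rcases tele_cases r₁ with ⟨r', hr⟩ | ⟨γ', r₁₁, j', w₁, hr⟩
  · -- the left whisker is telecore-free: the whiskered pair is a `free` pair
    subst hr
    cases c with
    | obs => exact absurd (eq_obs_of_fPath_obs r') (fun hc => by cases hc)
    | base κ =>
      have e := fun R => jS_comp₃ r' R w
      have hf : TGlueE G₁.E (jS.mapPath (r'.comp (u.comp w))) (jS.mapPath (r'.comp (v.comp w))) :=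
        TGlueE.free (G₁.isSaturated.precomp (G₁.isSaturated.postcomp hE w) r')
      refine (Δ.teleGlueη_heq_teleGlueη τ G₁ (e u) (e v) h' hf).trans ?_
      rw [Δ.teleGlueη_eq_η τ G₁ hf
        (TDec.free _ _ (G₁.isSaturated.precomp (G₁.isSaturated.postcomp hE w) r'))]
      exact Δ.tailη_whisker_heq τ G₁ hE r' w
  · -- the left whisker splits: the whiskered pair is a split pair with equal prefixes
    subst hr
    have e := fun R => split_comp_jS_comp r₁₁ j' w₁ R w
    have hrel : w₁.comp (u.comp w) = w₁.comp (v.comp w) ∨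
        G₁.E (w₁.comp (u.comp w)) (w₁.comp (v.comp w)) :=
      Or.inr (G₁.isSaturated.precomp (G₁.isSaturated.postcomp hE w) w₁)
    refine (Δ.teleGlueη_heq_η τ G₁ (e u) (e v) h' (TDec.tele r₁₁ r₁₁ j' _ _ hrel)).trans ?_
    rw [TDec.η_tele_eq, (Δ.anUnivE τ).η_refl, Category.id_comp]
    refine (Δ.teleTail_heq τ G₁ r₁₁ j' hrel).trans ?_
    refine (Functor.whiskerLeft_heq rfl (by rw [Δ.pathFunctor_jS_comp₃ τ])
      (by rw [Δ.pathFunctor_jS_comp₃ τ]) (Functor.whiskerLeft_heq rfl (Δ.pathFunctor_jS_comp₃ τ w₁ u w)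
        (Δ.pathFunctor_jS_comp₃ τ w₁ v w) (Δ.θtail_whisker_heq τ G₁ (Or.inr hE) w₁ w hrel))).trans ?_
    rw [Δ.θtail_of_E τ G₁ (Or.inr hE) hE]
    -- re-bracket (definitional) and merge `𝒟_{[r₁₁]} ⋙ 𝒟_{φ} ⋙ 𝒟_{jS w₁} = 𝒟_{[r₁]}`
    exact Functor.whiskerLeft_heq (Δ.pathFunctor_split τ r₁₁ j' w₁).symm rfl rfl
      (HEq.refl (Functor.whiskerRight (Δ.tailη τ G₁ hE)
        ((Δ.teleDiagram anJ (Δ.anTelMap τ)).pathFunctor (jS.mapPath w))))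

omit hover in
/-- **Whiskering of a split pair along a telecore-free right whisker `jS w`**: the whiskered pair is
the split pair with prefixes `[r₁]·[γᵢ]` and tails `u·w`, `v·w`; its universal part whiskers by the
whiskering axiom of `anUnivE`, its tail part by that of `G₁`.
[cite: MochizukiAbsTopIII2015, Corollary 3.6 (iii) p.81] -/
theorem teleGlueη_whisker_tele {c a : (teleShape anJ.{u}).Vertex} {γ β δ : SubVertex {a : LFVertex | a.row ≤ 4}}
    (p q : Path a (teleShape anJ.{u}).obs) (j : anJ.{u} γ)
    (u v : Path (⟨(teleShape anJ.{u}).base γ⟩ : FVtx.{u}) ⟨(teleShape anJ.{u}).base β⟩)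
    (huv : u = v ∨ G₁.E u v) (r₁ : Path c a)
    (w : Path (⟨(teleShape anJ.{u}).base β⟩ : FVtx.{u}) ⟨(teleShape anJ.{u}).base δ⟩)
    (h' : TGlueE G₁.E (r₁.comp (((p.cons (phiEdge j)).comp (jS.mapPath u)).comp (jS.mapPath w)))
      (r₁.comp (((q.cons (phiEdge j)).comp (jS.mapPath v)).comp (jS.mapPath w)))) :
    Δ.teleGlueη τ G₁ h' =
      eqToHom (Δ.pathFunctor_comp₃ τ r₁ _ _) ≫
        Functor.whiskerLeft ((Δ.teleDiagram anJ (Δ.anTelMap τ)).pathFunctor r₁)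
          (Functor.whiskerRight (TDec.tele p q j u v huv : Δ.TDec τ G₁ _ _).η
            ((Δ.teleDiagram anJ (Δ.anTelMap τ)).pathFunctor (jS.mapPath w))) ≫
        eqToHom (Δ.pathFunctor_comp₃ τ r₁ _ _).symm := by
  rw [TDec.η_tele_eq, Functor.whiskerRight_comp, Functor.whiskerLeft_comp]
  refine (conj_eqToHom_iff_heq _ _ (Δ.pathFunctor_comp₃ τ r₁ _ _)
    (Δ.pathFunctor_comp₃ τ r₁ _ _)).mpr ?_
  have hrel := Δ.tailRel_postcomp' τ G₁ huv w
  refine (Δ.teleGlueη_heq_η τ G₁ (comp_split_comp r₁ p j u w) (comp_split_comp r₁ q j v w) h'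
    (TDec.tele (r₁.comp p) (r₁.comp q) j _ _ hrel)).trans ?_
  rw [TDec.η_tele_eq]
  -- the universal part whiskers by the whiskering axiom of `anUnivE`
  have WA : (Δ.anUnivE τ).η (Δ.anUnivE_E_tele τ (r₁.comp p) (r₁.comp q) j (u.comp w)) ≍
      Functor.whiskerLeft ((Δ.teleDiagram anJ (Δ.anTelMap τ)).pathFunctor r₁)
        (Functor.whiskerRight ((Δ.anUnivE τ).η (Δ.anUnivE_E_tele τ p q j u))
          ((Δ.teleDiagram anJ (Δ.anTelMap τ)).pathFunctor (jS.mapPath w))) := by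
    refine ((Δ.anUnivE τ).η_heq_η (comp_split_comp r₁ p j u w).symm
      (comp_split_comp r₁ q j u w).symm _
      ((Δ.anUnivE τ).isSaturated.precomp ((Δ.anUnivE τ).isSaturated.postcomp
        (Δ.anUnivE_E_tele τ p q j u) (jS.mapPath w)) r₁)).trans ?_
    rw [(Δ.anUnivE τ).η_whisker]
    exact HomotopyFamily.heq_eqToHom_comp_comp_eqToHom _ _ _
  -- the tail part whiskers by the whiskering axiom of `G₁`
  have E' : (Δ.teleDiagram anJ (Δ.anTelMap τ)).pathFunctor (jS.mapPath (u.comp w)) =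
      (Δ.teleDiagram anJ (Δ.anTelMap τ)).pathFunctor (jS.mapPath u) ⋙
        (Δ.teleDiagram anJ (Δ.anTelMap τ)).pathFunctor (jS.mapPath w) := by
    rw [Prefunctor.mapPath_comp, pathFunctor_comp]
  have E'' : (Δ.teleDiagram anJ (Δ.anTelMap τ)).pathFunctor (jS.mapPath (v.comp w)) =
      (Δ.teleDiagram anJ (Δ.anTelMap τ)).pathFunctor (jS.mapPath v) ⋙
        (Δ.teleDiagram anJ (Δ.anTelMap τ)).pathFunctor (jS.mapPath w) := by
    rw [Prefunctor.mapPath_comp, pathFunctor_comp]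
  have WB : Δ.teleTail τ G₁ (r₁.comp q) j (u.comp w) (v.comp w) hrel ≍
      Functor.whiskerLeft ((Δ.teleDiagram anJ (Δ.anTelMap τ)).pathFunctor r₁)
        (Functor.whiskerRight (Δ.teleTail τ G₁ q j u v huv)
          ((Δ.teleDiagram anJ (Δ.anTelMap τ)).pathFunctor (jS.mapPath w))) := by
    refine (Δ.teleTail_heq τ G₁ (r₁.comp q) j hrel).trans ?_
    refine (Functor.whiskerLeft_heq rfl (by rw [E']) (by rw [E''])
      (Functor.whiskerLeft_heq rfl E' E'' (Δ.θtail_postcomp_heq τ G₁ huv w hrel))).trans ?_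
    refine (Functor.whiskerLeft_heq ((Δ.teleDiagram anJ (Δ.anTelMap τ)).pathFunctor_comp r₁ q) rfl rfl
      (HEq.refl (Functor.whiskerLeft ((Δ.teleDiagram anJ (Δ.anTelMap τ)).map (phiEdge j))
        (Functor.whiskerRight (Δ.θtail τ G₁ u v huv)
          ((Δ.teleDiagram anJ (Δ.anTelMap τ)).pathFunctor (jS.mapPath w)))))).trans ?_
    -- re-bracket (definitional) and fold `teleTail`
    exact Functor.whiskerLeft_heq (F := (Δ.teleDiagram anJ (Δ.anTelMap τ)).pathFunctor r₁) rfl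
      (by rw [pathFunctor_split]) (by rw [pathFunctor_split])
      (Functor.whiskerRight_heq (Δ.pathFunctor_split τ q j u).symm (Δ.pathFunctor_split τ q j v).symm
        (Δ.teleTail_heq τ G₁ q j huv).symm rfl)
  exact heq_comp
    ((congrArg (Δ.teleDiagram anJ (Δ.anTelMap τ)).pathFunctor (comp_split_comp r₁ p j u w)).symm.trans
      (Δ.pathFunctor_comp₃ τ r₁ _ _))
    ((congrArg (Δ.teleDiagram anJ (Δ.anTelMap τ)).pathFunctor (comp_split_comp r₁ q j u w)).symm.trans
      (Δ.pathFunctor_comp₃ τ r₁ _ _))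
    ((congrArg (Δ.teleDiagram anJ (Δ.anTelMap τ)).pathFunctor (comp_split_comp r₁ q j v w)).symm.trans
      (Δ.pathFunctor_comp₃ τ r₁ _ _)) WA WB

/-- **Whiskering of the glued homotopies at a target vertex of `𝒟_{≤4}`** (Def. 3.5 (ii), whiskering
axiom). [cite: MochizukiAbsTopIII2015, Definition 3.5 (ii) p.75] -/
theorem teleGlueη_whisker_base {c a b : (teleShape anJ.{u}).Vertex} {δ : SubVertex {a : LFVertex | a.row ≤ 4}}
    {P Q : Path a b} (h : TGlueE G₁.E P Q) (r₁ : Path c a) (r₂ : Path b ((teleShape anJ.{u}).base δ))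
    (h' : TGlueE G₁.E (r₁.comp (P.comp r₂)) (r₁.comp (Q.comp r₂))) :
    Δ.teleGlueη τ G₁ h' =
      eqToHom (Δ.pathFunctor_comp₃ τ r₁ P r₂) ≫
        Functor.whiskerLeft ((Δ.teleDiagram anJ (Δ.anTelMap τ)).pathFunctor r₁)
          (Functor.whiskerRight (Δ.teleGlueη τ G₁ h) ((Δ.teleDiagram anJ (Δ.anTelMap τ)).pathFunctor r₂)) ≫
        eqToHom (Δ.pathFunctor_comp₃ τ r₁ Q r₂).symm := by
  rcases tele_cases r₂ with ⟨w, hw⟩ | ⟨γ, r₂₁, j, w, hw⟩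
  · -- the right whisker is telecore-free
    subst hw
    obtain ⟨d⟩ := Δ.nonempty_tDec τ G₁ h
    rw [Δ.teleGlueη_eq_η τ G₁ h d]
    cases d with
    | obs p q => exact absurd (eq_obs_of_fPath_obs w) (fun hc => by cases hc)
    | free u v hE => exact Δ.teleGlueη_whisker_free τ G₁ u v hE r₁ w h'
    | tele p q j u v huv => exact Δ.teleGlueη_whisker_tele τ G₁ p q j u v huv r₁ w h'
  · -- the right whisker visits `Anab`
    have hw' : r₂ = r₂₁.comp (tailPath j w) := by rw [hw, split_eq_comp_tailPath]
    subst hw'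
    exact Δ.teleGlueη_whisker_through_obs τ G₁ hover h r₁ r₂₁ (tailPath j w) h'

end Whisker

/-! ### Cor. 3.6 (iii), second clause, telecore half — the two identities at `𝒩` discharged -/

/-- **[AbsTopIII] Cor. 3.6 (iii), second clause, telecore half** — `LogObsCompatTelecoreStmt τ` — from a
family `G₁` of homotopies on the telecore-free part `Γ⃗_𝒮` of `𝒟_An` whose homotopies lie over `ℰ`
(`hover`) and which contains the `𝔖_log` family `H` along `logToF` (`hlog`), for `id_⋎` fully
faithful (`hν`): the telecore `𝔗_An` over `ℰ` and the glued family on `𝒟_An`, which contains the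
telecore family `𝒥` and `H` — with the two identities at `𝒩` of `logObsCompatTelecoreStmt_of_family`
discharged by `teleGlueη_trans_base`, `teleGlueη_whisker_base`.
[cite: MochizukiAbsTopIII2015, Corollary 3.6 (iii) p.80] -/
theorem logObsCompatTelecoreStmt_of_family' (hν : Δ.toNexus.FullyFaithful)
    (hover : ∀ ⦃x y : FVtx.{u}⦄ ⦃u v : Path x y⦄ (h : G₁.E u v),
      (Δ.teleOverE τ).IsOver (jS.mapPath u) (jS.mapPath v) (Δ.tailη τ G₁ h))
    (H : Δ.sub3.HomotopyFamily) (hH : Δ.IsLogObservableFamily H) (hlog : H.CompatibleAlong logToF G₁) :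
    Δ.LogObsCompatTelecoreStmt τ :=
  Δ.logObsCompatTelecoreStmt_of_family τ G₁ hν hover
    (fun _ _ _ _ _ h₁ h₂ => Δ.teleGlueη_trans_base τ G₁ h₁ h₂ _)
    (fun _ _ _ _ _ _ h r₁ r₂ => Δ.teleGlueη_whisker_base τ G₁ hover h r₁ r₂ _) H hH hlog

end LogFrobeniusData

end Literature.AnabelianGeometry.AbsoluteAnabelian
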